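import Mathlib
import HarnessLib

/-!
# Random sparse multigraphs, I: the model and the cut bound (toward the CMM gap graphs)

[topic Combinatorics/Optimization]

The graph family behind the Charikar–Makarychev–Makarychev MAX-CUT gap (the tree's named fact
`CharikarMakarychevMakarychev2009_gapGraphs`, `MaxCutGapGraphs.lean`) is obtained in print from
random `∆`-regular graphs: "It is known (see [1], [6], [18]) that for every `ε > 0` there exists `∆`
such that with high probability every cut in a random `∆`-regular graph cuts at most `1/2 + ε`
fraction of all edges" ([CharikarMakarychevMakarychev2009] p. 10), the other properties coming from
the first-moment alterations of [AroraBollobasLovaszTourlakis2006] Lemma 2.8 ("consider the space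
of random graphs `G(n, p)` with `p = λ/n` … modulo a few small alterations", p. 26).

This file sets up an elementary finite model in which both computations are plain counting — the
**random pair multigraph**: `M` independent uniformly random ORDERED PAIRS of vertices,
`ω : Fin M → Fin n × Fin n`, all `(n²)^M` outcomes equally likely — and proves the cut bound by the
exponential-moment (Chernoff) method, entirely by finite sums:

* `sum_prod_eq_pow` — independence as the product formula `Σ_ω Π_i g(ω i) = (Σ_p g p)^M`;
  `card_filter_mul_le_sum` — Markov's inequality in counting form;
* `cutCount x ω = #{i : x cuts the pair ω i}`; `two_mul_card_cutPairs_le` — at most half of the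
  `n²` ordered pairs are cut by any `x : Fin n → Bool`;
* `sum_exp_cutCount_le` — `Σ_ω e^{t·cut} ≤ (n²)^M e^{M(t/2 + t²/8)}` (`cosh y ≤ e^{y²/2}`);
* `card_cut_ge_le` — `#{ω : cut_x(ω) ≥ (1/2+ε)M} ≤ (n²)^M e^{−2ε²M}` (`t = 4ε`), and the union
  bound over the `2^n` cuts, `card_exists_cut_ge_le`.

Everything is proved; no named facts.  (Sequel: loops, repeated pairs, degrees, short cycles and
locally dense sets by first moments, and the assembly of `CharikarMakarychevMakarychev2009_gapGraphs`.)

## References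

* [CharikarMakarychevMakarychev2009] STOC 2009, §5 p. 10 (random regular graphs, the cut property).
* [AroraBollobasLovaszTourlakis2006] Theory of Computing 2 (2006), Lemma 2.8 and its proof
  (p. 26–27: first-moment method with alterations).  Held text `paper:doi-10-1109-sfcs-2002-1181954`.
-/

noncomputable section

open Finset Real

namespace Literature.Combinatorics.Optimization

namespace RandomPairs

variable {n M : ℕ}

/-! ### Independence = product formula; Markov -/

/-- **Product formula** (independence of the `M` pairs): `Σ_ω Π_i g(ω_i) = (Σ_p g(p))^M`.
[cite: AroraBollobasLovaszTourlakis2006, Lemma 2.8 proof (p. 26: "the space of random graphs")] -/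
theorem sum_prod_eq_pow {α : Type*} [Fintype α] (g : α → ℝ) :
    ∑ ω : Fin M → α, ∏ i, g (ω i) = (∑ p, g p) ^ M := by
  classical
  rw [← Fintype.piFinset_univ, ← Finset.prod_univ_sum (fun _ : Fin M => (univ : Finset α))
    (fun _ p => g p), prod_const, card_univ, Fintype.card_fin]

/-- **Markov's inequality, counting form**: `#{ω : a ≤ f ω} · a ≤ Σ_ω f ω` for `f ≥ 0`.
[cite: AroraBollobasLovaszTourlakis2006, Lemma 2.8 proof (p. 27: "by Markov's inequality")] -/
theorem card_filter_mul_le_sum {α : Type*} [Fintype α] (f : α → ℝ) (hf : ∀ a, 0 ≤ f a) (a : ℝ)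
    [DecidablePred fun ω => a ≤ f ω] :
    (((univ : Finset α).filter fun ω => a ≤ f ω).card : ℝ) * a ≤ ∑ ω, f ω := by
  calc (((univ : Finset α).filter fun ω => a ≤ f ω).card : ℝ) * a
      = ∑ ω ∈ (univ : Finset α).filter (fun ω => a ≤ f ω), a := by rw [sum_const, nsmul_eq_mul]
    _ ≤ ∑ ω ∈ (univ : Finset α).filter (fun ω => a ≤ f ω), f ω :=
        sum_le_sum fun ω hω => (mem_filter.1 hω).2
    _ ≤ ∑ ω, f ω := sum_le_sum_of_subset_of_nonneg (filter_subset _ _) fun ω _ _ => hf ω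

/-! ### Cuts -/

/-- The number of sampled pairs cut by the bipartition `x`. [cite: CharikarMakarychevMakarychev2009, §5 (p. 10: "every cut … cuts at most 1/2 + ε fraction of all edges")] -/
def cutCount (x : Fin n → Bool) (ω : Fin M → Fin n × Fin n) : ℕ :=
  ((univ : Finset (Fin M)).filter fun i => x (ω i).1 ≠ x (ω i).2).card

/-- The ordered pairs cut by `x`. [cite: CharikarMakarychevMakarychev2009, §5 (p. 10)] -/
def cutPairs (x : Fin n → Bool) : Finset (Fin n × Fin n) :=
  (univ : Finset (Fin n × Fin n)).filter fun p => x p.1 ≠ x p.2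

/-- **At most half of the ordered pairs are cut**: `2·#cutPairs = 4u(n−u) ≤ n²` (`u = |x⁻¹(true)|`).
[cite: CharikarMakarychevMakarychev2009, §5 (p. 10)] -/
theorem two_mul_card_cutPairs_le (x : Fin n → Bool) : 2 * (cutPairs x).card ≤ n * n := by
  classical
  set T := (univ : Finset (Fin n)).filter fun a => x a = true with hT
  set F := (univ : Finset (Fin n)).filter fun a => ¬ x a = true with hF
  have hTF : T.card + F.card = n := by
    rw [hT, hF, Finset.card_filter_add_card_filter_not, card_univ, Fintype.card_fin]
  have hcut : cutPairs x = T ×ˢ F ∪ F ×ˢ T := by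
    ext p
    simp only [cutPairs, mem_filter, mem_univ, true_and, mem_union, mem_product, hT, hF]
    constructor
    · intro h
      cases hx : x p.1 <;> cases hy : x p.2 <;> simp_all
    · rintro (⟨h1, h2⟩ | ⟨h1, h2⟩) <;> simp_all
  have hdisj : Disjoint (T ×ˢ F) (F ×ˢ T) := by
    rw [Finset.disjoint_left]
    rintro ⟨a, b⟩ h1 h2
    rw [mem_product] at h1 h2
    exact (mem_filter.1 h2.1).2 (mem_filter.1 h1.1).2
  rw [hcut, card_union_of_disjoint hdisj, card_product, card_product]
  have key : 4 * (T.card * F.card) ≤ (T.card + F.card) * (T.card + F.card) := by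
    nlinarith [Nat.zero_le (T.card - F.card), sq_nonneg ((T.card : ℤ) - F.card)]
  rw [hTF] at key
  nlinarith

/-- **The exponential moment of the cut count**: `Σ_ω e^{t·cut_x(ω)} = ((n² − K) + K e^t)^M` with
`K = #cutPairs x`. [cite: AroraBollobasLovaszTourlakis2006, Lemma 2.8 proof (p. 26–27)] -/
theorem sum_exp_cutCount (x : Fin n → Bool) (t : ℝ) :
    ∑ ω : Fin M → Fin n × Fin n, exp (t * cutCount x ω) =
      (((n * n : ℕ) : ℝ) - (cutPairs x).card + (cutPairs x).card * exp t) ^ M := by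
  classical
  have hω : ∀ ω : Fin M → Fin n × Fin n, exp (t * cutCount x ω) =
      ∏ i, exp (t * if x (ω i).1 ≠ x (ω i).2 then 1 else 0) := by
    intro ω
    rw [← Real.exp_sum, ← Finset.mul_sum]
    congr 2
    rw [cutCount, Finset.card_filter]
    push_cast
    rfl
  simp_rw [hω]
  rw [sum_prod_eq_pow (fun p : Fin n × Fin n => exp (t * if x p.1 ≠ x p.2 then 1 else 0))]
  congr 1
  rw [← Finset.sum_filter_add_sum_filter_not univ (fun p : Fin n × Fin n => x p.1 ≠ x p.2)]
  have h1 : ∑ p ∈ univ.filter (fun p : Fin n × Fin n => x p.1 ≠ x p.2),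
      exp (t * if x p.1 ≠ x p.2 then 1 else 0) = (cutPairs x).card * exp t := by
    rw [Finset.sum_congr rfl fun p hp => by rw [if_pos (mem_filter.1 hp).2, mul_one], sum_const,
      nsmul_eq_mul]
    rfl
  have h2 : ∑ p ∈ univ.filter (fun p : Fin n × Fin n => ¬ x p.1 ≠ x p.2),
      exp (t * if x p.1 ≠ x p.2 then 1 else 0) =
      ((univ.filter (fun p : Fin n × Fin n => ¬ x p.1 ≠ x p.2)).card : ℝ) := by
    rw [Finset.sum_congr rfl fun p hp => by rw [if_neg (mem_filter.1 hp).2, mul_zero, exp_zero],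
      sum_const, nsmul_eq_mul, mul_one]
  have hsplit : (cutPairs x).card + (univ.filter (fun p : Fin n × Fin n => ¬ x p.1 ≠ x p.2)).card =
      n * n := by
    rw [cutPairs, Finset.card_filter_add_card_filter_not, card_univ, Fintype.card_prod, Fintype.card_fin]
  rw [h1, h2]
  have : ((univ.filter (fun p : Fin n × Fin n => ¬ x p.1 ≠ x p.2)).card : ℝ) =
      ((n * n : ℕ) : ℝ) - (cutPairs x).card := by
    rw [← hsplit]; push_cast; ring
  rw [this]; ring

/-- `(1 + e^t)/2 ≤ e^{t/2 + t²/8}` (from `cosh y ≤ e^{y²/2}`). [cite: AroraBollobasLovaszTourlakis2006, Lemma 2.8 proof (p. 26–27)] -/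
theorem one_add_exp_div_two_le (t : ℝ) : (1 + exp t) / 2 ≤ exp (t / 2 + t ^ 2 / 8) := by
  have h := Real.cosh_le_exp_half_sq (t / 2)
  rw [Real.cosh_eq] at h
  have e1 : exp (t / 2 + t ^ 2 / 8) = exp (t / 2) * exp ((t / 2) ^ 2 / 2) := by
    rw [← Real.exp_add]; ring_nf
  have e2 : (1 + exp t) / 2 = exp (t / 2) * ((exp (t / 2) + exp (-(t / 2))) / 2) := by
    rw [mul_div_assoc', mul_add, ← Real.exp_add, ← Real.exp_add]
    ring_nf
    rw [Real.exp_zero]; ring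
  rw [e1, e2]
  exact mul_le_mul_of_nonneg_left h (exp_pos _).le

/-- **Exponential moment bound**: `Σ_ω e^{t·cut_x(ω)} ≤ (n²)^M · e^{M(t/2 + t²/8)}` for `t ≥ 0`.
[cite: AroraBollobasLovaszTourlakis2006, Lemma 2.8 proof (p. 26–27)] -/
theorem sum_exp_cutCount_le (x : Fin n → Bool) {t : ℝ} (ht : 0 ≤ t) :
    ∑ ω : Fin M → Fin n × Fin n, exp (t * cutCount x ω) ≤
      ((n * n : ℕ) : ℝ) ^ M * exp (M * (t / 2 + t ^ 2 / 8)) := by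
  rw [sum_exp_cutCount]
  set K : ℝ := ((cutPairs x).card : ℝ) with hK
  have hK2 : 2 * K ≤ ((n * n : ℕ) : ℝ) := by
    rw [hK]; exact_mod_cast two_mul_card_cutPairs_le x
  have hK0 : 0 ≤ K := by rw [hK]; exact Nat.cast_nonneg _
  have het : 1 ≤ exp t := Real.one_le_exp ht
  have hbase : ((n * n : ℕ) : ℝ) - K + K * exp t ≤ ((n * n : ℕ) : ℝ) * exp (t / 2 + t ^ 2 / 8) := by
    calc ((n * n : ℕ) : ℝ) - K + K * exp t = ((n * n : ℕ) : ℝ) + K * (exp t - 1) := by ring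
      _ ≤ ((n * n : ℕ) : ℝ) + ((n * n : ℕ) : ℝ) / 2 * (exp t - 1) := by
          have : K ≤ ((n * n : ℕ) : ℝ) / 2 := by linarith
          nlinarith
      _ = ((n * n : ℕ) : ℝ) * ((1 + exp t) / 2) := by ring
      _ ≤ ((n * n : ℕ) : ℝ) * exp (t / 2 + t ^ 2 / 8) :=
          mul_le_mul_of_nonneg_left (one_add_exp_div_two_le t) (Nat.cast_nonneg _)
  have hbase0 : 0 ≤ ((n * n : ℕ) : ℝ) - K + K * exp t := by nlinarith
  calc (((n * n : ℕ) : ℝ) - K + K * exp t) ^ M ≤ (((n * n : ℕ) : ℝ) * exp (t / 2 + t ^ 2 / 8)) ^ M :=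
        pow_le_pow_left₀ hbase0 hbase M
    _ = ((n * n : ℕ) : ℝ) ^ M * exp (M * (t / 2 + t ^ 2 / 8)) := by
        rw [mul_pow, ← Real.exp_nat_mul]

/-- **The cut bound (Chernoff)**: the outcomes in which the cut `x` cuts at least `(1/2 + ε)M` of
the `M` pairs number at most `(n²)^M e^{−2ε²M}`.
[cite: CharikarMakarychevMakarychev2009, §5 (p. 10); AroraBollobasLovaszTourlakis2006, Lemma 2.8 proof (p. 26–27)] -/
theorem card_cut_ge_le (x : Fin n → Bool) {ε : ℝ} (hε : 0 ≤ ε) :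
    ((((univ : Finset (Fin M → Fin n × Fin n)).filter fun ω =>
        (1 / 2 + ε) * M ≤ (cutCount x ω : ℝ)).card : ℝ)) ≤
      ((n * n : ℕ) : ℝ) ^ M * exp (-(2 * ε ^ 2 * M)) := by
  classical
  set t : ℝ := 4 * ε with ht
  have ht0 : 0 ≤ t := by rw [ht]; linarith
  set a : ℝ := (1 / 2 + ε) * M with ha
  -- Markov on `e^{t·cut}` at level `e^{ta}`
  have hmarkov := card_filter_mul_le_sum (fun ω : Fin M → Fin n × Fin n => exp (t * cutCount x ω))
    (fun _ => (exp_pos _).le) (exp (t * a))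
  have hset : ((univ : Finset (Fin M → Fin n × Fin n)).filter fun ω => exp (t * a) ≤ exp (t * cutCount x ω)) ⊇
      (univ.filter fun ω => a ≤ (cutCount x ω : ℝ)) := by
    intro ω hω
    refine mem_filter.2 ⟨mem_univ _, ?_⟩
    exact Real.exp_le_exp.2 (mul_le_mul_of_nonneg_left (mem_filter.1 hω).2 ht0)
  have hle : (((univ : Finset (Fin M → Fin n × Fin n)).filter fun ω => a ≤ (cutCount x ω : ℝ)).card : ℝ) *
      exp (t * a) ≤ ((n * n : ℕ) : ℝ) ^ M * exp (M * (t / 2 + t ^ 2 / 8)) := by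
    calc _ ≤ (((univ : Finset (Fin M → Fin n × Fin n)).filter fun ω =>
            exp (t * a) ≤ exp (t * cutCount x ω)).card : ℝ) * exp (t * a) := by
          gcongr
      _ ≤ ∑ ω : Fin M → Fin n × Fin n, exp (t * cutCount x ω) := hmarkov
      _ ≤ _ := sum_exp_cutCount_le x ht0
  have hexp : ((n * n : ℕ) : ℝ) ^ M * exp (M * (t / 2 + t ^ 2 / 8)) =
      ((n * n : ℕ) : ℝ) ^ M * exp (-(2 * ε ^ 2 * M)) * exp (t * a) := by
    rw [mul_assoc, ← Real.exp_add]; congr 2; rw [ht, ha]; ring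
  rw [hexp] at hle
  exact le_of_mul_le_mul_right hle (exp_pos _)

/-- **Union bound over all cuts**: at most `2^n (n²)^M e^{−2ε²M}` outcomes have SOME cut with
`≥ (1/2+ε)M` cut pairs. [cite: CharikarMakarychevMakarychev2009, §5 (p. 10)] -/
theorem card_exists_cut_ge_le {ε : ℝ} (hε : 0 ≤ ε) :
    ((((univ : Finset (Fin M → Fin n × Fin n)).filter fun ω =>
        ∃ x : Fin n → Bool, (1 / 2 + ε) * M ≤ (cutCount x ω : ℝ)).card : ℝ)) ≤
      2 ^ n * (((n * n : ℕ) : ℝ) ^ M * exp (-(2 * ε ^ 2 * M))) := by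
  classical
  have hsub : ((univ : Finset (Fin M → Fin n × Fin n)).filter fun ω =>
        ∃ x : Fin n → Bool, (1 / 2 + ε) * M ≤ (cutCount x ω : ℝ)) ⊆
      (univ : Finset (Fin n → Bool)).biUnion fun x =>
        univ.filter fun ω => (1 / 2 + ε) * M ≤ (cutCount x ω : ℝ) := by
    intro ω hω
    obtain ⟨x, hx⟩ := (mem_filter.1 hω).2
    exact mem_biUnion.2 ⟨x, mem_univ _, mem_filter.2 ⟨mem_univ _, hx⟩⟩
  calc _ ≤ (((univ : Finset (Fin n → Bool)).biUnion fun x =>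
          univ.filter fun ω => (1 / 2 + ε) * M ≤ (cutCount x ω : ℝ)).card : ℝ) := by
        exact_mod_cast card_le_card hsub
    _ ≤ ∑ x : Fin n → Bool, (((univ : Finset (Fin M → Fin n × Fin n)).filter fun ω =>
          (1 / 2 + ε) * M ≤ (cutCount x ω : ℝ)).card : ℝ) := by
        exact_mod_cast card_biUnion_le
    _ ≤ ∑ x : Fin n → Bool, ((n * n : ℕ) : ℝ) ^ M * exp (-(2 * ε ^ 2 * M)) :=
        sum_le_sum fun x _ => card_cut_ge_le x hε
    _ = 2 ^ n * (((n * n : ℕ) : ℝ) ^ M * exp (-(2 * ε ^ 2 * M))) := by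
        rw [sum_const, card_univ, Fintype.card_fun, Fintype.card_bool, Fintype.card_fin, nsmul_eq_mul]
        push_cast; ring

end RandomPairs

end Literature.Combinatorics.Optimization
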